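import Mathlib
import Summits.Ventures.LatticeQCDFlow.TrivializingMaps.WitnessColumnRP
import HarnessLib

/-!
# THEOREM W for the canonical witness: the spatial plaquette of one time slice

HONEST FRAMING: exact (Metropolis-corrected) sampling algorithms for lattice gauge theory; figures of
merit are autocorrelation/cost numbers at stated couplings and volumes; no continuum-physics claim.

Companion of `WitnessColumnRP` (THEOREM W). THEOREM W is stated for an arbitrary bounded measurable
observable `X` of the spatial links of the slice `x₀ = 0`. This file discharges those three
hypotheses for the witness the cell actually measures, `X = Re tr ρ(U_p)` for a SPATIAL plaquette
`p = (x; i < j)` based in the slice (`x₀ = 0`, `i, j ≠ 0`; Wave 0's `WilsonRP.plaqRe ρ U p`):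
* `dependsOn_plaqRe_slice` — `X` reads only the four spatial links of `p`, all in `sliceEdges d L 0`;
* measurability and the bound `|X| ≤ N` are the tree's `WilsonRP.measurable_plaqRe`,
  `WilsonRP.abs_plaqRe_le`;
whence, with NO hypothesis on the observable left (any real `β`, any compact `G`, continuous `ρ`,
`L` even, any `d`): `plaqRe_sliceCov_even_nonneg` (`K_p(2a) ≥ 0`), `plaqRe_sliceCov_sq_le`
(`K_p(a+b)² ≤ K_p(2a) K_p(2b)`), `plaqRe_sliceCov_geometric_lower` (`v_p (c_{p,2}/v_p)ʲ ≤ K_p(2j)`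
for `j ≤ L/2` once the two measured numbers `v_p = Var`, `c_{p,2} = Cov` at separation two are
positive), and the docking `Gauge.sep_le_two_mul_range_of_plaquette` (`G = SU(n)`): an exact
range-`r` proposal with mean Metropolis–Hastings acceptance `≥ acc` has `sep(2j) ≤ 2r` whenever
`4 (1 - acc) N² < v_p (c_{p,2}/v_p)ʲ`. Here `K_p(t) = sliceCov ρ β (plaqRe ρ · p) t` is the
plaquette–plaquette connected correlator at time separation `t` (same spatial position).

NOT CLAIMED: positivity of `v_p`, `c_{p,2}` (measured; `c_{p,2} = 0` at `β = 0`); odd separations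
(see `WitnessColumnLinkRP`, `β ≥ 0`); continuum statements.

References: K. Osterwalder, E. Seiler, Ann. Phys. 110 (1978) 440, §2; M. Lüscher, Commun. Math.
Phys. 293 (2010) 899.
-/

noncomputable section

namespace Summit.Ventures.LatticeQCDFlow.TrivializingMaps

open MeasureTheory
open scoped ComplexOrder ComplexConjugate

namespace WitnessColumn

open Literature.MathematicalPhysics.QuantumFieldTheory

variable {d L : ℕ} [NeZero d] [NeZero L] {G : Type*}

omit [NeZero L] in
/-- A spatial plaquette based in the slice `x₀ = 0` reads only spatial links of that slice:
`U ↦ Re tr ρ(U_p)` depends only on `sliceEdges d L 0`. -/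
theorem dependsOn_plaqRe_slice [Group G] {N : ℕ} (ρ : G →* Matrix (Fin N) (Fin N) ℂ)
    {p : Plaquette d L} (hp0 : p.1 0 = 0) (hi : p.2.1.1 ≠ 0) (hj : p.2.1.2 ≠ 0) :
    DependsOn (fun U : GaugeConfig d L G => WilsonRP.plaqRe ρ U p) (sliceEdges d L 0) := by
  intro U V hUV
  have h1 : U (p.1, p.2.1.1) = V (p.1, p.2.1.1) := hUV _ ⟨hi, hp0⟩
  have h2 : U (p.1.shift p.2.1.1, p.2.1.2) = V (p.1.shift p.2.1.1, p.2.1.2) :=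
    hUV _ ⟨hj, by show p.1.shift _ 0 = 0; rw [WilsonRP.shift_apply_of_ne _ hi.symm]; exact hp0⟩
  have h3 : U (p.1.shift p.2.1.2, p.2.1.1) = V (p.1.shift p.2.1.2, p.2.1.1) :=
    hUV _ ⟨hi, by show p.1.shift _ 0 = 0; rw [WilsonRP.shift_apply_of_ne _ hj.symm]; exact hp0⟩
  have h4 : U (p.1, p.2.1.2) = V (p.1, p.2.1.2) := hUV _ ⟨hj, hp0⟩
  simp only [WilsonRP.plaqRe, plaquetteHolonomy, h1, h2, h3, h4]

section PlaquetteColumn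

variable [Group G] [TopologicalSpace G] [IsTopologicalGroup G] [CompactSpace G] [MeasurableSpace G]
  [BorelSpace G] {N : ℕ} (ρ : G →* Matrix (Fin N) (Fin N) ℂ)

/-- **THEOREM W (a) for the plaquette** (any real `β`, `L` even, `a ≤ L/2`): the connected
plaquette–plaquette correlator at even time separation is non-negative, `0 ≤ K_p(2a)`. -/
theorem plaqRe_sliceCov_even_nonneg (hL : Even L) (hρ : Continuous ρ) (β : ℝ) {p : Plaquette d L}
    (hp0 : p.1 0 = 0) (hi : p.2.1.1 ≠ 0) (hj : p.2.1.2 ≠ 0) {a : ℕ} (ha : a ≤ L / 2) :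
    0 ≤ sliceCov ρ β (fun U : GaugeConfig d L G => WilsonRP.plaqRe ρ U p) ((2 * a : ℕ) : ZMod L) :=
  sliceCov_even_nonneg ρ hL hρ β (WilsonRP.measurable_plaqRe ρ hρ p) (C := (N : ℝ))
    (fun U => WilsonRP.abs_plaqRe_le ρ hρ U p) (dependsOn_plaqRe_slice ρ hp0 hi hj) ha

/-- **THEOREM W (b) for the plaquette** (any real `β`, `L` even, `a, b ≤ L/2`):
`K_p(a+b)² ≤ K_p(2a) · K_p(2b)`. -/
theorem plaqRe_sliceCov_sq_le (hL : Even L) (hρ : Continuous ρ) (β : ℝ) {p : Plaquette d L}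
    (hp0 : p.1 0 = 0) (hi : p.2.1.1 ≠ 0) (hj : p.2.1.2 ≠ 0) {a b : ℕ} (ha : a ≤ L / 2)
    (hb : b ≤ L / 2) :
    sliceCov ρ β (fun U : GaugeConfig d L G => WilsonRP.plaqRe ρ U p) ((a + b : ℕ) : ZMod L) ^ 2
      ≤ sliceCov ρ β (fun U : GaugeConfig d L G => WilsonRP.plaqRe ρ U p) ((2 * a : ℕ) : ZMod L)
        * sliceCov ρ β (fun U : GaugeConfig d L G => WilsonRP.plaqRe ρ U p) ((2 * b : ℕ) : ZMod L) :=
  sliceCov_sq_le ρ hL hρ β (WilsonRP.measurable_plaqRe ρ hρ p) (C := (N : ℝ))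
    (fun U => WilsonRP.abs_plaqRe_le ρ hρ U p) (dependsOn_plaqRe_slice ρ hp0 hi hj) ha hb

/-- **THEOREM W (c) for the plaquette** (any real `β`, `L` even): if `v_p := K_p(0) > 0` and
`c_{p,2} := K_p(2) > 0` then `v_p (c_{p,2}/v_p)ʲ ≤ K_p(2j)` for every `j ≤ L/2` — NO hypothesis on
the observable is left; the only inputs are the two measured numbers. -/
theorem plaqRe_sliceCov_geometric_lower (hL : Even L) (hρ : Continuous ρ) (β : ℝ)
    {p : Plaquette d L} (hp0 : p.1 0 = 0) (hi : p.2.1.1 ≠ 0) (hj : p.2.1.2 ≠ 0)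
    (hv : 0 < sliceCov ρ β (fun U : GaugeConfig d L G => WilsonRP.plaqRe ρ U p) 0)
    (hc : 0 < sliceCov ρ β (fun U : GaugeConfig d L G => WilsonRP.plaqRe ρ U p) 2) {j : ℕ}
    (hjL : j ≤ L / 2) :
    sliceCov ρ β (fun U : GaugeConfig d L G => WilsonRP.plaqRe ρ U p) 0
        * (sliceCov ρ β (fun U : GaugeConfig d L G => WilsonRP.plaqRe ρ U p) 2
          / sliceCov ρ β (fun U : GaugeConfig d L G => WilsonRP.plaqRe ρ U p) 0) ^ j
      ≤ sliceCov ρ β (fun U : GaugeConfig d L G => WilsonRP.plaqRe ρ U p) ((2 * j : ℕ) : ZMod L) :=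
  sliceCov_geometric_lower ρ hL hρ β (WilsonRP.measurable_plaqRe ρ hρ p) (C := (N : ℝ))
    (fun U => WilsonRP.abs_plaqRe_le ρ hρ U p) (dependsOn_plaqRe_slice ρ hp0 hi hj) hv hc hjL

end PlaquetteColumn

/-! ## Docking for the plaquette witness -/

namespace Gauge

open Literature.MathematicalPhysics.QuantumFieldTheory.Luscher2010

variable {d L n N : ℕ} [NeZero d] [NeZero L]

/-- **THEOREM W (d) for the plaquette** (lattice `SU(n)`, any real `β`, `L` even, any `d ≥ 3`,
`n`, `ρ`): under the hypotheses of the sharp footprint law (`π = wilsonMeasure ρ β`, proposal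
`Φ_* ν` of range `r` in the link pseudo-metric `dist`, mean MH acceptance `≥ acc`), for a spatial
plaquette `p` based in the slice `x₀ = 0` with `v_p = K_p(0) > 0`, `c_{p,2} = K_p(2) > 0`: if the
slices `0` and `2j` (`j ≤ L/2`) are `sep`-separated and `4 (1 - acc) N² < v_p (c_{p,2}/v_p)ʲ`, then
`sep ≤ 2 r`. Witnesses: `Re tr ρ(U_p)` and its time translate by `2j`; bound `C = N`. -/
theorem sep_le_two_mul_range_of_plaquette (hL : Even L)
    (ρ : Matrix.specialUnitaryGroup (Fin n) ℂ →* Matrix (Fin N) (Fin N) ℂ) (hρ : Continuous ρ) (β : ℝ)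
    (dist : Edge d L → Edge d L → ℕ) (hsymm : ∀ e e', dist e e' = dist e' e)
    (htri : ∀ e e' e'', dist e e'' ≤ dist e e' + dist e' e'')
    {Φ : GaugeConfig d L (Matrix.specialUnitaryGroup (Fin n) ℂ) →
      GaugeConfig d L (Matrix.specialUnitaryGroup (Fin n) ℂ)} (hΦm : Measurable Φ)
    {q : GaugeConfig d L (Matrix.specialUnitaryGroup (Fin n) ℂ) → ℝ} (hq0 : ∀ U, 0 ≤ q U)
    (hqm : Measurable q)
    (hν : (trivialMeasure (Matrix.specialUnitaryGroup (Fin n) ℂ) d L).map Φ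
      = (trivialMeasure (Matrix.specialUnitaryGroup (Fin n) ℂ) d L).withDensity
          fun U => ENNReal.ofReal (q U))
    {Nb : Edge d L → Set (Edge d L)} (hΦ : ∀ e, DependsOn (fun W => Φ W e) (Nb e)) {r : ℕ}
    (hN : ∀ e, ∀ e' ∈ Nb e, dist e e' ≤ r) {acc : ℝ}
    (hacc : acc ≤ ∫ U, ∫ U', min
        (Real.exp (-(β * wilsonAction ρ U)) / (partitionFn fun W :
          GaugeConfig d L (Matrix.specialUnitaryGroup (Fin n) ℂ) => β * wilsonAction ρ W).toReal * q U')
        (Real.exp (-(β * wilsonAction ρ U')) / (partitionFn fun W :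
          GaugeConfig d L (Matrix.specialUnitaryGroup (Fin n) ℂ) => β * wilsonAction ρ W).toReal * q U)
        ∂(trivialMeasure (Matrix.specialUnitaryGroup (Fin n) ℂ) d L)
        ∂(trivialMeasure (Matrix.specialUnitaryGroup (Fin n) ℂ) d L))
    {p : Plaquette d L} (hp0 : p.1 0 = 0) (hi : p.2.1.1 ≠ 0) (hj : p.2.1.2 ≠ 0)
    (hv : 0 < sliceCov ρ β (fun U : GaugeConfig d L (Matrix.specialUnitaryGroup (Fin n) ℂ) =>
      WilsonRP.plaqRe ρ U p) 0)
    (hc : 0 < sliceCov ρ β (fun U : GaugeConfig d L (Matrix.specialUnitaryGroup (Fin n) ℂ) =>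
      WilsonRP.plaqRe ρ U p) 2)
    {j : ℕ} (hjL : j ≤ L / 2) {sep : ℕ}
    (hfar : ∀ e ∈ sliceEdges d L 0, ∀ e' ∈ sliceEdges d L ((2 * j : ℕ) : ZMod L), sep ≤ dist e e')
    (hacc_j : 4 * (1 - acc) * ((N : ℝ) * N)
      < sliceCov ρ β (fun U : GaugeConfig d L (Matrix.specialUnitaryGroup (Fin n) ℂ) =>
            WilsonRP.plaqRe ρ U p) 0
        * (sliceCov ρ β (fun U : GaugeConfig d L (Matrix.specialUnitaryGroup (Fin n) ℂ) =>
              WilsonRP.plaqRe ρ U p) 2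
          / sliceCov ρ β (fun U : GaugeConfig d L (Matrix.specialUnitaryGroup (Fin n) ℂ) =>
              WilsonRP.plaqRe ρ U p) 0) ^ j) :
    sep ≤ 2 * r :=
  Gauge.sep_le_two_mul_range_of_sliceCov hL ρ hρ β dist hsymm htri hΦm hq0 hqm hν hΦ hN hacc
    (WilsonRP.measurable_plaqRe ρ hρ p) (fun U => WilsonRP.abs_plaqRe_le ρ hρ U p)
    (dependsOn_plaqRe_slice ρ hp0 hi hj) hv hc hjL hfar hacc_j

end Gauge

end WitnessColumn

end Summit.Ventures.LatticeQCDFlow.TrivializingMaps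

end
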